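import Literature.NumberTheory.GaloisRepresentations.BrauerTower
import Literature.NumberTheory.GaloisRepresentations.CyclicNormLayer
import HarnessLib

/-!
# The cyclic layer of the Brauer-group bound (Serre, *Corps locaux* XIII §3, VIII §4)

For a field `k` of characteristic zero, a finite Galois `L₁/k` inside `k̄`, subgroups
`D' ≤ D ≤ Gal(L₁/k)` with `D'` normal in `D` of prime index `p` (fixed fields `E ⊆ E'`, a cyclic
layer of degree `p`), and the absolute Galois groups `N = Gal(k̄/E)`, `N' = Gal(k̄/E')`
(`layerN`, `layerN'` of `CyclicNormLayer.lean`), we bound the relative Brauer group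
`Br(E'/E) = ker(res : H²(N, k̄ˣ) → H²(N', k̄ˣ))`:

* `Literature.NumberTheory.GaloisRepresentations.layerChar` — the cyclic character
  `χ : N → N/N' ≃ ℤ/p` attached to a generator of `N/N'`, with kernel `N'` (`ker_layerChar`);
* `Literature.NumberTheory.GaloisRepresentations.layerBaseUnit` — an `N`-invariant element of
  `k̄ˣ` is a unit of `E` (characteristic zero: `k̄^N = E`);
* `Literature.NumberTheory.GaloisRepresentations.exists_cycNorm_eq_of_mem_ker_layerNormQuotHom` —
  an `N`-invariant unit which is a norm from `E'` is a cyclic norm `N_s b = Π_{i<p} sⁱ b` of an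
  `N'`-invariant `b ∈ k̄ˣ` (`prod_layerQuotRes_eq_norm`);
* `Literature.NumberTheory.GaloisRepresentations.natCard_resKer_layer_le` — **the layer bound**:
  if for all finite `K/k` and finite cyclic Galois `L/K` the norm index `(Kˣ : N_{L/K} Lˣ)` equals
  `[L : K]` (the `H⁰` part of the class field axiom, Neukirch V (1.1) for local fields), then
  `Br(E'/E)` is finite of order `≤ p`: the cyclic-layer bound `natCard_resKer_le_of_cyclicLayer`
  (`|ker res| ≤ |(k̄ˣ)^N / N₀|` for any `N₀` killed by the cup-product `κ`, using
  `H¹(N', k̄ˣ) = 0`, Hilbert 90) with `N₀ =` the norms from `E'`, which are cyclic norms and hence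
  killed by `κ` (`cyclicClass_cycNorm`), and `(Eˣ : N E'ˣ) = p`.

This is the layer step of the proof that `|Br(L/K)| ≤ [L : K]` for local fields
(Serre XIII §3 Prop. 8 via VIII §4 and the norm index computation V §3 / Neukirch V (1.1)).

## References
* J.-P. Serre, *Corps locaux*, Hermann, 1968 (3e éd. 1980), VIII §4, XIII §3. [SerreLocalFields1979]
* J. Neukirch, *Algebraic Number Theory*, Springer, 1999, Ch. V §1 Thm. (1.1). [NeukirchANT1999]
* J.-P. Serre, *Galois Cohomology*, Springer, 1997, II §3.1. [SerreGaloisCohomology1997]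
-/

noncomputable section

open CategoryTheory Topology Field IntermediateField Function

universe u

namespace Literature.NumberTheory.GaloisRepresentations

open _root_.TopRep _root_.ContRepresentation _root_.ContinuousCohomology DiscreteGaloisModule
open _root_.Field _root_.IntermediateField _root_.Function LocalWeilDatum

/-! ### Generalities -/

section General

variable {G : Type u} [Group G] [TopologicalSpace G] [IsTopologicalGroup G]
variable {A : Type u} [AddCommGroup A] [TopologicalSpace A] [DiscreteTopology A]

/-- `resKer ρ (h : T ≤ S)` only depends on the subgroup `T`. [folklore] -/
theorem resKer_congr (ρ : ContinuousRep G ℤ A) {T₁ T₂ S : Subgroup G} (e : T₁ = T₂)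
    (h₁ : T₁ ≤ S) (h₂ : T₂ ≤ S) : resKer ρ h₁ = resKer ρ h₂ := by
  subst e
  rfl

end General

/-- **`|G / ker φ| ≤ |H|`** for an additive homomorphism `φ : G → H` into a finite group
(`kerLift` is injective). [folklore] -/
theorem finite_quotient_ker_le {G : Type*} [AddGroup G] {H : Type*} [AddGroup H] [Finite H]
    (φ : G →+ H) : Finite (G ⧸ φ.ker) ∧ Nat.card (G ⧸ φ.ker) ≤ Nat.card H := by
  have hinj := QuotientAddGroup.kerLift_injective φ
  exact ⟨Finite.of_injective _ hinj, Nat.card_le_card_of_injective _ hinj⟩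

/-- **A product over a finite cyclic group is a product over the powers of a generator.**
[folklore] -/
theorem prod_univ_eq_prod_range_pow {Q : Type*} [Group Q] [Fintype Q] {M : Type*} [CommMonoid M]
    (s : Q) (hs : ∀ x, x ∈ Subgroup.zpowers s) {d : ℕ} (hcard : Nat.card Q = d) (f : Q → M) :
    ∏ c, f c = ∏ i ∈ Finset.range d, f (s ^ i) := by
  classical
  have hord : orderOf s = d := (orderOf_eq_card_of_forall_mem_zpowers hs).trans hcard
  have hinj : Set.InjOn (fun i => s ^ i) (Finset.range d : Set ℕ) := by
    intro i hi j hj h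
    rw [Finset.coe_range, ← hord] at hi hj
    exact pow_injOn_Iio_orderOf hi hj h
  have himage : (Finset.range d).image (fun i => s ^ i) = Finset.univ := by
    apply Finset.eq_univ_of_card
    rw [Finset.card_image_of_injOn hinj, Finset.card_range, ← hcard, Nat.card_eq_fintype_card]
  rw [← himage, Finset.prod_image hinj]

section Layer

variable {k : Type u} [Field k]
variable (L₁ : IntermediateField k (AlgebraicClosure k)) [FiniteDimensional k L₁] [IsGalois k L₁]
variable {D D' : Subgroup (L₁ ≃ₐ[k] L₁)}

/-! ### The cyclic character of the layer -/

section Char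

variable [((layerN' L₁ D').subgroupOf (layerN L₁ D)).Normal]

/-- **The cyclic character of the layer**: for a generator `s` of `N/N'` of order `d` (and `N'`
open in `N`), `χ(σ) = i` where `σ N' = sⁱ` (`zmodMulEquivOfGenerator`).
[cite: SerreLocalFields1979, VIII §4] -/
noncomputable def layerChar {d : ℕ} [NeZero d] (s : layerN L₁ D ⧸ layerS L₁ D D')
    (hs : ∀ x, x ∈ Subgroup.zpowers s) (hcard : Nat.card (layerN L₁ D ⧸ layerS L₁ D D') = d)
    (hSopen : IsOpen ((layerS L₁ D D' : Subgroup (layerN L₁ D)) : Set (layerN L₁ D))) :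
    CyclicCharacter (layerN L₁ D) d where
  toFun σ := Multiplicative.toAdd
    ((zmodMulEquivOfGenerator hs hcard).symm (σ : layerN L₁ D ⧸ layerS L₁ D D'))
  map_mul' σ τ := by
    rw [QuotientGroup.mk_mul, map_mul, toAdd_mul]
  continuous_toFun := by
    haveI : DiscreteTopology (layerN L₁ D ⧸ layerS L₁ D D') :=
      QuotientGroup.discreteTopology hSopen
    exact (continuous_of_discreteTopology (f := fun q : layerN L₁ D ⧸ layerS L₁ D D' =>
      Multiplicative.toAdd ((zmodMulEquivOfGenerator hs hcard).symm q))).comp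
        (QuotientGroup.continuous_mk (N := layerS L₁ D D'))
  surjective' i := by
    obtain ⟨σ, hσ⟩ := QuotientGroup.mk_surjective
      ((zmodMulEquivOfGenerator hs hcard) (Multiplicative.ofAdd i))
    exact ⟨σ, by simp only [hσ, MulEquiv.symm_apply_apply, toAdd_ofAdd]⟩

variable {d : ℕ} [NeZero d] (s : layerN L₁ D ⧸ layerS L₁ D D')
    (hs : ∀ x, x ∈ Subgroup.zpowers s) (hcard : Nat.card (layerN L₁ D ⧸ layerS L₁ D D') = d)
    (hSopen : IsOpen ((layerS L₁ D D' : Subgroup (layerN L₁ D)) : Set (layerN L₁ D)))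

omit [FiniteDimensional k L₁] in
/-- Unfolding `layerChar`. [folklore] -/
theorem layerChar_apply (σ : layerN L₁ D) :
    layerChar L₁ s hs hcard hSopen σ = Multiplicative.toAdd
      ((zmodMulEquivOfGenerator hs hcard).symm (σ : layerN L₁ D ⧸ layerS L₁ D D')) := rfl

omit [FiniteDimensional k L₁] in
/-- **The kernel of the layer character is `N ∩ N'`.** [folklore] -/
theorem ker_layerChar : (layerChar L₁ s hs hcard hSopen).ker = layerS L₁ D D' := by
  ext σ
  rw [CyclicCharacter.mem_ker, layerChar_apply, ← QuotientGroup.eq_one_iff,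
    ← (zmodMulEquivOfGenerator hs hcard).symm.map_eq_one_iff (x := (σ : layerN L₁ D ⧸ _))]
  exact ⟨fun h => Multiplicative.toAdd.injective (h.trans toAdd_one.symm),
    fun h => by rw [h, toAdd_one]⟩

omit [FiniteDimensional k L₁] in
/-- A lift of the generator has character `1`. [folklore] -/
theorem layerChar_eq_one {σ : layerN L₁ D} (hσ : (σ : layerN L₁ D ⧸ layerS L₁ D D') = s) :
    layerChar L₁ s hs hcard hSopen σ = 1 := by
  rw [layerChar_apply, hσ, zmodMulEquivOfGenerator_symm_apply_generator]
  rfl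

end Char

/-! ### Invariant units are units of the base -/

section BaseUnit

variable (D)

/-- The unit of `k̄` underlying an `N`-invariant, in `k̄`. [folklore] -/
abbrev invVal (a : (layerRep L₁ D).toTopRep.ρ.invariants) : AlgebraicClosure k :=
  ((unitsVal k (a : UnitsCarrier k) : (AlgebraicClosure k)ˣ) : AlgebraicClosure k)

omit [FiniteDimensional k L₁] in
/-- An `N`-invariant is fixed by `N = Gal(k̄/E)`. [folklore] -/
theorem smul_invVal (a : (layerRep L₁ D).toTopRep.ρ.invariants) (n : layerN L₁ D) :
    (n : absoluteGaloisGroup k) • invVal L₁ D a = invVal L₁ D a := by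
  exact congrArg (fun w : UnitsCarrier k => ((unitsVal k w : (AlgebraicClosure k)ˣ) :
    AlgebraicClosure k)) (a.2 n)

/-- **`k̄^N = E` on units (characteristic zero)**: the unit underlying an `N`-invariant lies in
`E = L₁^D ⊆ k̄`. [folklore] -/
theorem invVal_mem_lift [CharZero k] (a : (layerRep L₁ D).toTopRep.ρ.invariants) :
    invVal L₁ D a ∈ lift (fixedField D) := by
  obtain ⟨m, hm⟩ := exists_pow_mem_of_forall_smul_eq (lift (fixedField D)) (invVal L₁ D a)
    (fun σ hσ => by
      rw [← layerN_eq_galFixing] at hσ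
      exact smul_invVal L₁ D a ⟨σ, hσ⟩)
  simpa only [ringExpChar.eq_one, one_pow, pow_one] using hm

/-- The `N`-invariant as an element of `E = L₁^D`. [folklore] -/
noncomputable def layerBaseOfInv [CharZero k] (a : (layerRep L₁ D).toTopRep.ρ.invariants) : layerBase L₁ D :=
  ⟨⟨invVal L₁ D a, lift_le _ (invVal_mem_lift L₁ D a)⟩, (mem_lift _).1 (invVal_mem_lift L₁ D a)⟩

/-- `layerBaseOfInv a` is `a` in `k̄`. [folklore] -/
@[simp] theorem coe_coe_layerBaseOfInv [CharZero k] (a : (layerRep L₁ D).toTopRep.ρ.invariants) :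
    (((layerBaseOfInv L₁ D a : layerBase L₁ D) : L₁) : AlgebraicClosure k) = invVal L₁ D a := rfl

/-- `layerBaseOfInv a ≠ 0`. [folklore] -/
theorem layerBaseOfInv_ne_zero [CharZero k] (a : (layerRep L₁ D).toTopRep.ρ.invariants) :
    layerBaseOfInv L₁ D a ≠ 0 := by
  intro h
  have h' := congrArg (fun e : layerBase L₁ D => ((e : L₁) : AlgebraicClosure k)) h
  simp only [coe_coe_layerBaseOfInv] at h'
  exact (unitsVal k (a : UnitsCarrier k)).ne_zero h'

/-- **The `N`-invariant units as units of `E`.** [folklore] -/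
noncomputable def layerBaseUnit [CharZero k] (a : (layerRep L₁ D).toTopRep.ρ.invariants) : (layerBase L₁ D)ˣ :=
  Units.mk0 (layerBaseOfInv L₁ D a) (layerBaseOfInv_ne_zero L₁ D a)

/-- `layerBaseUnit a` is `a` in `k̄`. [folklore] -/
@[simp] theorem coe_coe_layerBaseUnit [CharZero k] (a : (layerRep L₁ D).toTopRep.ρ.invariants) :
    ((((layerBaseUnit L₁ D a : (layerBase L₁ D)ˣ) : layerBase L₁ D) : L₁) : AlgebraicClosure k) =
      invVal L₁ D a := rfl

/-- `layerBaseUnit` is additive-to-multiplicative. [folklore] -/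
theorem layerBaseUnit_add [CharZero k] (a b : (layerRep L₁ D).toTopRep.ρ.invariants) :
    layerBaseUnit L₁ D (a + b) = layerBaseUnit L₁ D a * layerBaseUnit L₁ D b := by
  apply Units.ext
  apply Subtype.ext
  apply Subtype.ext
  rfl

end BaseUnit

/-! ### The norm quotient map and its kernel -/

section NormQuot

variable (D D')

/-- The norm subgroup `N_{E'/E} E'ˣ ≤ Eˣ` of the layer. [cite: SerreLocalFields1979, XIII §3] -/
abbrev layerNormRange : Subgroup (layerBase L₁ D)ˣ :=
  (Units.map (Algebra.norm (layerBase L₁ D) (S := layerTop L₁ D D') :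
    layerTop L₁ D D' →* layerBase L₁ D)).range

/-- **The map `(k̄ˣ)^N = Eˣ → Eˣ / N E'ˣ`** as an additive homomorphism. [folklore] -/
noncomputable def layerNormQuotHom [CharZero k] : (layerRep L₁ D).toTopRep.ρ.invariants →+
    Additive ((layerBase L₁ D)ˣ ⧸ layerNormRange L₁ D D') :=
  (MonoidHom.toAdditive (QuotientGroup.mk' (layerNormRange L₁ D D'))).comp
    (AddMonoidHom.mk' (fun a => Additive.ofMul (layerBaseUnit L₁ D a)) (layerBaseUnit_add L₁ D))

/-- Unfolding `layerNormQuotHom`. [folklore] -/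
theorem layerNormQuotHom_apply [CharZero k] (a : (layerRep L₁ D).toTopRep.ρ.invariants) :
    layerNormQuotHom L₁ D D' a = Additive.ofMul (QuotientGroup.mk (layerBaseUnit L₁ D a)) := rfl

variable {D D'}
variable (hDD : D' ≤ D) (hn : (D'.subgroupOf D).Normal)
variable [((layerN' L₁ D').subgroupOf (layerN L₁ D)).Normal]

/-- The unit of `k̄ˣ` attached to a nonzero element of `E'`. [folklore] -/
noncomputable def unitOfTop (y : layerTop L₁ D D') (hy : ((y : L₁) : AlgebraicClosure k) ≠ 0) :
    UnitsCarrier k :=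
  UnitsCarrier.ofUnits (Units.mk0 _ hy)

omit [FiniteDimensional k L₁] [IsGalois k L₁]
  [((layerN' L₁ D').subgroupOf (layerN L₁ D)).Normal] in
/-- `unitOfTop y` is `y` in `k̄`. [folklore] -/
@[simp] theorem coe_unitsVal_unitOfTop (y : layerTop L₁ D D')
    (hy : ((y : L₁) : AlgebraicClosure k) ≠ 0) :
    ((unitsVal k (unitOfTop L₁ y hy) : (AlgebraicClosure k)ˣ) : AlgebraicClosure k) =
      ((y : L₁) : AlgebraicClosure k) := rfl

omit [((layerN' L₁ D').subgroupOf (layerN L₁ D)).Normal] in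
include hDD in
/-- `unitOfTop y` is `N'`-invariant. [folklore] -/
theorem layerRep_unitOfTop_of_mem (y : layerTop L₁ D D') (hy : ((y : L₁) : AlgebraicClosure k) ≠ 0)
    (t : layerN L₁ D) (ht : t ∈ layerS L₁ D D') :
    layerRep L₁ D t (unitOfTop L₁ y hy) = unitOfTop L₁ y hy := by
  apply unitsVal_injective k
  apply Units.ext
  rw [ContinuousRep.restrict_apply, subgroupIncl_apply, unitsVal_apply, Units.coe_smul,
    coe_unitsVal_unitOfTop, ← coe_resGal_apply]
  exact congrArg (fun z : L₁ => (z : AlgebraicClosure k))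
    ((mem_layerTop_iff L₁ hDD ((y : layerTop L₁ D D') : L₁)).1 y.2 _ ht)

include hDD hn in
/-- **Cyclic norms are norms**: for a lift `σ` of a generator `s` of `N/N'` of order `d` and
`y ∈ E'` nonzero, `N_σ (y) = Π_{i<d} σⁱ y = N_{E'/E}(y)` in `k̄`
(`prod_layerQuotRes_eq_norm` and `prod_univ_eq_prod_range_pow`). [cite: SerreLocalFields1979, VIII §4] -/
theorem unitsVal_cycNorm_unitOfTop [Fintype (layerN L₁ D ⧸ layerS L₁ D D')] {d : ℕ}
    (s : layerN L₁ D ⧸ layerS L₁ D D') (hs : ∀ x, x ∈ Subgroup.zpowers s)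
    (hcard : Nat.card (layerN L₁ D ⧸ layerS L₁ D D') = d) {σ : layerN L₁ D}
    (hσ : (σ : layerN L₁ D ⧸ layerS L₁ D D') = s)
    (y : layerTop L₁ D D') (hy : ((y : L₁) : AlgebraicClosure k) ≠ 0) :
    ((unitsVal k ((layerRep L₁ D).cycNorm σ d (unitOfTop L₁ y hy)) : (AlgebraicClosure k)ˣ) :
        AlgebraicClosure k) =
      (((algebraMap (layerBase L₁ D) (layerTop L₁ D D') (Algebra.norm (layerBase L₁ D) y) :
        layerTop L₁ D D') : L₁) : AlgebraicClosure k) := by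
  rw [← prod_layerQuotRes_eq_norm L₁ hDD hn y, prod_univ_eq_prod_range_pow s hs hcard,
    ContinuousRep.cycNorm, ContinuousRep.powSum, unitsVal_sum, Units.coe_prod]
  refine Finset.prod_congr rfl fun i _ => ?_
  rw [← hσ, ← QuotientGroup.mk_pow, layerQuotRes_mk, coe_layerRes_apply,
    ContinuousRep.restrict_apply, subgroupIncl_apply, unitsVal_apply, Units.coe_smul,
    coe_unitsVal_unitOfTop, Subgroup.coe_pow]

include hDD hn in
/-- **An invariant unit which is a norm from `E'` is a cyclic norm of an `N'`-invariant unit.**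
[cite: SerreLocalFields1979, VIII §4] -/
theorem exists_cycNorm_eq_of_mem_ker_layerNormQuotHom [CharZero k]
    [Fintype (layerN L₁ D ⧸ layerS L₁ D D')] {d : ℕ}
    (s : layerN L₁ D ⧸ layerS L₁ D D') (hs : ∀ x, x ∈ Subgroup.zpowers s)
    (hcard : Nat.card (layerN L₁ D ⧸ layerS L₁ D D') = d) {σ : layerN L₁ D}
    (hσ : (σ : layerN L₁ D ⧸ layerS L₁ D D') = s)
    (a : (layerRep L₁ D).toTopRep.ρ.invariants) (ha : a ∈ (layerNormQuotHom L₁ D D').ker) :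
    ∃ b : UnitsCarrier k, (∀ t ∈ layerS L₁ D D', layerRep L₁ D t b = b) ∧
      (layerRep L₁ D).cycNorm σ d b = (a : UnitsCarrier k) := by
  rw [AddMonoidHom.mem_ker, layerNormQuotHom_apply, ofMul_eq_zero, QuotientGroup.eq_one_iff] at ha
  obtain ⟨y, hy⟩ := ha
  have hy' : Algebra.norm (layerBase L₁ D) ((y : (layerTop L₁ D D')ˣ) : layerTop L₁ D D') =
      (layerBaseUnit L₁ D a : layerBase L₁ D) := by
    rw [← hy]
    rfl
  have hy0 : ((((y : (layerTop L₁ D D')ˣ) : layerTop L₁ D D') : L₁) : AlgebraicClosure k) ≠ 0 := by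
    intro h0
    apply y.ne_zero
    apply Subtype.ext
    apply Subtype.ext
    exact h0
  refine ⟨unitOfTop L₁ _ hy0, fun t ht => layerRep_unitOfTop_of_mem L₁ hDD _ hy0 t ht, ?_⟩
  apply unitsVal_injective k
  apply Units.ext
  rw [unitsVal_cycNorm_unitOfTop L₁ hDD hn s hs hcard hσ _ hy0, hy']
  rfl

omit [((layerN' L₁ D').subgroupOf (layerN L₁ D)).Normal] in
/-- **The norm quotient has order `≤ (Eˣ : N E'ˣ)`**: `(k̄ˣ)^N / ker ↪ Eˣ / N E'ˣ`.
[folklore] -/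
theorem finite_quotient_ker_layerNormQuotHom [CharZero k] {p : ℕ}
    (hind : (layerNormRange L₁ D D').index = p) (hp : p ≠ 0) :
    Finite ((layerRep L₁ D).toTopRep.ρ.invariants ⧸ (layerNormQuotHom L₁ D D').ker) ∧
      Nat.card ((layerRep L₁ D).toTopRep.ρ.invariants ⧸ (layerNormQuotHom L₁ D D').ker) ≤ p := by
  haveI : Finite ((layerBase L₁ D)ˣ ⧸ layerNormRange L₁ D D') := by
    apply Nat.finite_of_card_ne_zero
    rw [← Subgroup.index_eq_card, hind]
    exact hp
  haveI : Finite (Additive ((layerBase L₁ D)ˣ ⧸ layerNormRange L₁ D D')) :=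
    inferInstanceAs (Finite ((layerBase L₁ D)ˣ ⧸ layerNormRange L₁ D D'))
  have h := finite_quotient_ker_le (H := Additive ((layerBase L₁ D)ˣ ⧸ layerNormRange L₁ D D'))
    (layerNormQuotHom L₁ D D')
  refine ⟨h.1, h.2.trans_eq ?_⟩
  rw [← hind, Subgroup.index_eq_card]
  rfl

end NormQuot

/-! ### The layer bound -/

attribute [local instance] compactSpace_of_isClosed_subgroup

variable (hDD : D' ≤ D) (hn : (D'.subgroupOf D).Normal)

include hDD hn in
/-- **The layer bound** `|Br(E'/E)| ≤ p` for a cyclic layer `E'/E` of prime degree `p` inside a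
finite Galois `L₁/k` (`k` of characteristic zero), granted the norm index equality
`(Kˣ : N_{L/K} Lˣ) = [L : K]` for the finite cyclic Galois extensions `L/K` of finite extensions
`K/k` (Neukirch V (1.1) for local fields): `ker(res : H²(Gal(k̄/E), k̄ˣ) → H²(Gal(k̄/E'), k̄ˣ))` is
finite of order at most `p`.  Proof: the cyclic-layer bound `natCard_resKer_le_of_cyclicLayer`
for the character `χ : Gal(k̄/E) → Gal(E'/E) ≃ ℤ/p` (Hilbert 90 for `Gal(k̄/E')`,
`subsingleton_one_units_galFixing`), with `N₀ =` the `N`-invariant units that are norms from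
`E'`: these are cyclic norms (`exists_cycNorm_eq_of_mem_ker_layerNormQuotHom`), hence killed by
`κ` (`cyclicClass_cycNorm`), and `|Eˣ / N E'ˣ| = p`.
[cite: SerreLocalFields1979, XIII §3 (proof of Prop. 8) and VIII §4] -/
theorem natCard_resKer_layer_le [CharZero k] {p : ℕ} [hp : Fact p.Prime]
    (hNI : ∀ (K L : Type u) [Field K] [Field L] [Algebra k K] [Algebra K L]
      [FiniteDimensional k K] [FiniteDimensional K L] [IsGalois K L] [IsCyclic (L ≃ₐ[K] L)],
      (Units.map (Algebra.norm K (S := L) : L →* K)).range.index = Module.finrank K L)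
    (hindex : D'.relIndex D = p) :
    Finite (resKer (units k) (layerN'_le L₁ hDD)) ∧
      Nat.card (resKer (units k) (layerN'_le L₁ hDD)) ≤ p := by
  classical
  haveI : NeZero p := ⟨hp.out.ne_zero⟩
  haveI : Fact (1 < p) := ⟨hp.out.one_lt⟩
  haveI : FiniteDimensional k (lift (fixedField D')) :=
    (liftAlgEquiv (fixedField D')).toLinearEquiv.finiteDimensional
  haveI : FiniteDimensional k (lift (fixedField D)) :=
    (liftAlgEquiv (fixedField D)).toLinearEquiv.finiteDimensional
  haveI hNc : IsClosed ((layerN L₁ D : Subgroup (absoluteGaloisGroup k)) :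
      Set (absoluteGaloisGroup k)) := by
    rw [layerN_eq_galFixing]
    exact isClosed_galFixing k _
  haveI : (layerS L₁ D D').Normal := normal_layerN'_subgroupOf L₁ hDD hn
  -- `H¹(N', k̄ˣ) = 0`
  have h1 : Subsingleton (continuousCohomology 1
      ((layerRep L₁ D).restrict (subgroupIncl (layerS L₁ D D'))).toTopRep) :=
    (subsingleton_iff_of_continuousMulEquiv (layerSEquiv L₁ hDD)
      ((units k).restrict (subgroupIncl (galFixing k (lift (fixedField D')))))
      ((layerRep L₁ D).restrict (subgroupIncl (layerS L₁ D D'))) (fun _ _ => rfl) 1).1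
      (subsingleton_one_units_galFixing (lift (fixedField D')))
  -- the quotient `N/N'` is cyclic of order `p`, discrete
  have hSopen : IsOpen ((layerS L₁ D D' : Subgroup (layerN L₁ D)) : Set (layerN L₁ D)) := by
    change IsOpen ((Subtype.val : layerN L₁ D → absoluteGaloisGroup k) ⁻¹' (layerN' L₁ D'))
    refine IsOpen.preimage continuous_subtype_val ?_
    rw [show (layerN' L₁ D' : Set (absoluteGaloisGroup k)) = galFixing k (lift (fixedField D')) by
      rw [galFixing_lift_fixedField]]
    exact isOpen_galFixing k _
  have hcard : Nat.card (layerN L₁ D ⧸ layerS L₁ D D') = p := by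
    rw [← Subgroup.index_eq_card]
    change (layerN' L₁ D').relIndex (layerN L₁ D) = p
    have h := relIndex_galFixing_lift_fixedField L₁ D' D
    rw [galFixing_lift_fixedField, galFixing_lift_fixedField] at h
    rw [h, hindex]
  haveI : Finite (layerN L₁ D ⧸ layerS L₁ D D') := Nat.finite_of_card_ne_zero (by
    rw [hcard]; exact hp.out.ne_zero)
  letI : Fintype (layerN L₁ D ⧸ layerS L₁ D D') := Fintype.ofFinite _
  haveI : IsCyclic (layerN L₁ D ⧸ layerS L₁ D D') := isCyclic_of_prime_card hcard
  obtain ⟨s, hs⟩ := IsCyclic.exists_generator (α := layerN L₁ D ⧸ layerS L₁ D D')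
  obtain ⟨σ, hσ⟩ := QuotientGroup.mk_surjective s
  -- the cyclic character
  let χ : CyclicCharacter (layerN L₁ D) p := layerChar L₁ s hs hcard hSopen
  have hker : χ.ker = layerS L₁ D D' := ker_layerChar L₁ s hs hcard hSopen
  have hχσ : χ σ = 1 := layerChar_eq_one L₁ s hs hcard hSopen hσ
  have hT : Subsingleton (continuousCohomology 1
      (((units k).restrict (subgroupIncl (layerN L₁ D))).restrict (subgroupIncl χ.ker)).toTopRep) := by
    rw [hker]
    exact h1
  -- the norm index
  haveI := isGalois_layerTop L₁ hDD hn
  haveI : FiniteDimensional (layerBase L₁ D) L₁ := IntermediateField.finiteDimensional_right _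
  haveI : FiniteDimensional (layerBase L₁ D) (layerTop L₁ D D') :=
    IntermediateField.finiteDimensional_left _
  haveI : IsCyclic (layerTop L₁ D D' ≃ₐ[layerBase L₁ D] layerTop L₁ D D') :=
    isCyclic_of_surjective (layerQuotRes L₁ hDD hn) (layerQuotRes_bijective L₁ hDD hn).2
  have hfin : Module.finrank (layerBase L₁ D) (layerTop L₁ D D') = p := by
    rw [← IsGalois.card_aut_eq_finrank, ← hcard]
    exact (Nat.card_congr (galQuotEquiv L₁ hDD hn)).symm
  have hind : (layerNormRange L₁ D D').index = p := by
    rw [← hfin]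
    exact hNI (layerBase L₁ D) (layerTop L₁ D D')
  -- `N₀ =` the norms, killed by `κ`
  let N₀ : AddSubgroup ((layerRep L₁ D).toTopRep.ρ.invariants) := (layerNormQuotHom L₁ D D').ker
  have hN₀ : ∀ a ∈ N₀, cyclicClass χ ((units k).restrict (subgroupIncl (layerN L₁ D))) a = 0 := by
    intro a ha
    obtain ⟨b, hb, hba⟩ :=
      exists_cycNorm_eq_of_mem_ker_layerNormQuotHom L₁ hDD hn s hs hcard hσ a ha
    have hb' : ∀ t ∈ χ.ker, layerRep L₁ D t b = b := fun t ht => hb t (hker ▸ ht)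
    have hab : a = ⟨(layerRep L₁ D).cycNorm σ p b,
        apply_cycNorm_eq χ (layerRep L₁ D) hχσ hb'⟩ := Subtype.ext hba.symm
    rw [hab]
    exact cyclicClass_cycNorm χ (layerRep L₁ D) hχσ hb'
  obtain ⟨hfinQ, hcardQ⟩ := finite_quotient_ker_layerNormQuotHom L₁ hind hp.out.ne_zero
  haveI := hfinQ
  -- the cyclic-layer bound
  obtain ⟨hfinK, hcardK⟩ := natCard_resKer_le_of_cyclicLayer (units k) χ hT N₀ hN₀
  have hmap : χ.ker.map (layerN L₁ D).subtype = layerN' L₁ D' := by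
    rw [hker]
    exact Subgroup.map_subgroupOf_eq_of_le (layerN'_le L₁ hDD)
  rw [resKer_congr (units k) hmap (map_subtype_le' χ.ker) (layerN'_le L₁ hDD)] at hfinK hcardK
  exact ⟨hfinK, hcardK.trans hcardQ⟩

end Layer

end Literature.NumberTheory.GaloisRepresentations

end
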